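import Summits.AtomisticToContinuum.FouriersLaw.Theorems.OddChargeExists.Negative.CoboundaryOverlap
import Summits.AtomisticToContinuum.FouriersLaw.Theorems.HiddenChargeMazurDressedChargeOddCoboundaryOfNoLocalIntegrals

/-!
# `OddChargeExists` / Negative (2): the crux needs a NON-TRIVIAL odd conservation law — ¬crux modulo `NoLocalIntegrals`

`--supports stmt-AtomisticToContinuum-13511` (crux `HiddenChargeMazur.OddChargeExists`, lead prover of line
`registered`).  NEGATIVE LEMMA MODULO `H` (lane `Theorems/<Crux>/Negative/`) with `H` an EXISTING route item:
`H = Summit.AtomisticToContinuum.FouriersLaw.Theses.LocalOhmBV.NoLocalIntegrals` (item stmt-AtomisticToContinuum-12074,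
open: every smooth local conservation law of the infinite pinned anharmonic chain is `c·e₀ + (h − h∘shift) + k`).

* `coboundary_not_extensive` — UNCONDITIONAL: an odd polynomial window density that is a shift-coboundary plus a
  constant never has extensive current overlap (`coboundary_overlap_bounded`, previous file);
* `oddChargeExists_needs_nonCoboundaryLaw` — UNCONDITIONAL: the crux implies the content of the registered stub
  `stub_oddConservationLaw` of line `registered` (an odd polynomial law at positive parameters that is NOT a
  shift-coboundary plus a constant), so that stub is NECESSARY as well as (with the landed thermodynamic limit)
  sufficient: the crux and its line stand or fall with one algebraic statement;
* `OddChargeExists_false_of_NoLocalIntegrals : NoLocalIntegrals → ¬ OddChargeExists` — through the landed bridge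
  `DressedCharge.stub_oddChargeCoboundary_of_noLocalIntegrals` (odd polynomial laws are polynomial coboundaries under
  `NoLocalIntegrals`).  Hence PROVING item stmt-AtomisticToContinuum-12074 REFUTES this crux (and closes the
  refutation-shaped route HiddenChargeMazur `refuted:OddChargeExists` with its bridge items standing).

Why `H` is not constructible here: it is the open classification of local conservation laws of the quartic pinned
chain (the lead's reduction: any odd counterexample has weight `2D+3`, span `D ≥ 6`, and solves the parameter-free
leading system `(LS)_D`, certified trivial for `D ≤ 5` — `Cruxes/OddChargeExists/STUB1-ANALYSIS.md`).
No definitions, no named facts, no `sorry`; all `[folklore]`.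
-/

noncomputable section

open MeasureTheory Set Function Finset Filter Topology
open scoped BigOperators

namespace Summit.AtomisticToContinuum.FouriersLaw.Theorems.OddChargeExists.Negative

open Literature.MathematicalPhysics.KineticTheory.HeatConduction OscillatorChain
open Summit.AtomisticToContinuum.FouriersLaw.Theses.HiddenChargeMazur (OddChargeExists)

/-- **Extensive overlap excludes coboundaries.**  If an odd polynomial window density of `pinnedChain ω₂ lam β γ`
(`ω₂, lam, β > 0`, `T > 0`) has extensive current overlap `c·N ≤ |∫ J_N Q_N dGibbs_{N,T}|` for `N ≥ N₀`, it is NOT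
a shift-coboundary plus a constant (`coboundary_overlap_bounded` makes the overlap `O(1)`). [folklore] -/
theorem coboundary_not_extensive {ω₂ lam β : ℝ} (hω : 0 < ω₂) (hl : 0 < lam) (hβ : 0 < β) (γ : ℝ) {T : ℝ}
    (hT : 0 < T) (R : ℕ) {g : (Fin (2 * R + 1) → ℝ × ℝ) → ℝ}
    (hg : ∃ p : MvPolynomial (Fin (2 * R + 1) ⊕ Fin (2 * R + 1)) ℝ, ∀ y : Fin (2 * R + 1) → ℝ × ℝ,
      g y = MvPolynomial.eval (Sum.elim (fun i => (y i).1) (fun i => (y i).2)) p)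
    (hodd : ∀ y : Fin (2 * R + 1) → ℝ × ℝ, g (fun i => ((y i).1, -(y i).2)) = -g y)
    (hext : ∃ c : ℝ, 0 < c ∧ ∃ N₀ : ℕ, ∀ N : ℕ, N₀ ≤ N → c * (N : ℝ) ≤
      |∫ z, (∑ i : Fin N, (pinnedChain ω₂ lam β γ).bondCurrent N i z) *
          (∑ x ∈ Finset.range (N - 2 * R), g (fun i => if h : x + i.val < N then (z.1 ⟨x + i.val, h⟩, z.2 ⟨x + i.val, h⟩)
            else (0, 0)))
        ∂((volume : Measure (PhaseSpace N)).tilted fun x => -(pinnedChain ω₂ lam β γ).hamiltonian N x / T)|) :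
    ¬ ∃ (h : (Fin (2 * R) → ℝ × ℝ) → ℝ) (k : ℝ), ∀ y : Fin (2 * R + 1) → ℝ × ℝ,
        g y = h (fun i : Fin (2 * R) => y i.succ) - h (fun i : Fin (2 * R) => y i.castSucc) + k := by
  intro hcob
  obtain ⟨c, hc, N₀, hN⟩ := hext
  obtain ⟨C, hC⟩ := coboundary_overlap_bounded hω hl hβ γ hT R hg hodd hcob
  -- a length beyond `N₀`, `2R+2` and `C/c`
  obtain ⟨N, hN0, hN1, hN2⟩ : ∃ N : ℕ, N₀ ≤ N ∧ 2 * R + 2 ≤ N ∧ C / c < (N : ℝ) := by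
    obtain ⟨M, hM⟩ := exists_nat_gt (C / c)
    exact ⟨max N₀ (max (2 * R + 2) M), le_max_left _ _, (le_max_left _ _).trans (le_max_right _ _),
      hM.trans_le (by exact_mod_cast (le_max_right _ _).trans (le_max_right _ _))⟩
  have h1 := hN N hN0
  have h2 := hC N hN1
  have h3 : C < c * (N : ℝ) := by rwa [div_lt_iff₀ hc, mul_comm] at hN2
  linarith

/-- **The crux implies a non-trivial odd conservation law (the content of `stub_oddConservationLaw`).**
UNCONDITIONAL: from `OddChargeExists` one gets parameters `ω₂, lam, β, γ > 0` and an odd polynomial window density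
with a polynomial local conservation law of the infinite pinned chain that is NOT a shift-coboundary plus a
constant — verbatim the registered stub `stub_oddConservationLaw` of line `registered`.  So the stub is not only
sufficient (with the landed thermodynamic limit) but NECESSARY for the crux. [folklore] -/
theorem oddChargeExists_needs_nonCoboundaryLaw (hE : OddChargeExists) :
    ∃ ω₂ lam β γ : ℝ, 0 < ω₂ ∧ 0 < lam ∧ 0 < β ∧ 0 < γ ∧ ∀ P : Literature.MathematicalPhysics.KineticTheory.HeatConduction.OscillatorChain, P = Literature.MathematicalPhysics.KineticTheory.HeatConduction.pinnedChain ω₂ lam β γ → ∃ (R : ℕ) (g : (Fin (2 * R + 1) → ℝ × ℝ) → ℝ) (ψ : (Fin (2 * (R + 1) + 1) → ℝ × ℝ) → ℝ), (∃ p : MvPolynomial (Fin (2 * R + 1) ⊕ Fin (2 * R + 1)) ℝ, ∀ y : Fin (2 * R + 1) → ℝ × ℝ, g y = MvPolynomial.eval (Sum.elim (fun i => (y i).1) (fun i => (y i).2)) p) ∧ (∃ p : MvPolynomial (Fin (2 * (R + 1) + 1) ⊕ Fin (2 * (R + 1) + 1)) ℝ, ∀ y : Fin (2 * (R + 1) +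 1) → ℝ × ℝ, ψ y = MvPolynomial.eval (Sum.elim (fun i => (y i).1) (fun i => (y i).2)) p) ∧ (∀ y : Fin (2 * R + 1) → ℝ × ℝ, g (fun i => ((y i).1, -(y i).2)) = -g y) ∧ (∀ σ : ℤ → ℝ × ℝ, (∑' x : ℤ, ((σ x).2 * deriv (fun t => g (fun i : Fin (2 * R + 1) => Function.update σ x (t, (σ x).2) ((i : ℤ) - (R : ℕ)))) (σ x).1 + (-deriv P.U (σ x).1 + (deriv P.V ((σ (x + 1)).1 - (σ x).1) - deriv P.V ((σ x).1 - (σ (x - 1)).1))) * deriv (fun t => g (fun i : Fin (2 * R + 1) => Function.update σ x ((σ x).1, t) ((i : ℤ) - (R : ℕ)))) (σ x).2)) = ψ (fun i : Fin (2 * (R + 1) + 1) => σ ((i : ℤ) - (R + 1 : ℕ))) - ψ (fun i : Fin (2 * (R + 1) + 1) => σ ((i : ℤ) - (R + 1 : ℕ) + 1))) ∧ ¬ ∃ (h : (Fin (2 * R) → ℝ × ℝ) → ℝ) (k : ℝ), ∀ y : Fin (2 * R + 1) → ℝ × ℝ, g y = h (fun i : Fin (2 * R) => y i.succ) - h (fun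 i : Fin (2 * R) => y i.castSucc) + k := by
  obtain ⟨ω₂, lam, β, γ, T, hω, hl, hβ, hγ, hT, hP⟩ := hE
  obtain ⟨R, g, ψ, hg, hψ, hodd, hcons, hext⟩ := hP _ rfl
  refine ⟨ω₂, lam, β, γ, hω, hl, hβ, hγ, ?_⟩
  rintro P rfl
  exact ⟨R, g, ψ, hg, hψ, hodd, hcons, coboundary_not_extensive hω hl hβ γ hT R hg hodd hext⟩

/-- **NEGATIVE LEMMA MODULO `NoLocalIntegrals`: the census of local conservation laws refutes the crux.**
`LocalOhmBV.NoLocalIntegrals → ¬ OddChargeExists`: under item stmt-AtomisticToContinuum-12074 every odd polynomial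
local conservation law of `pinnedChain` is the shift-coboundary of a polynomial profile (landed bridge
`DressedCharge.stub_oddChargeCoboundary_of_noLocalIntegrals`), and a coboundary has bounded current overlap
(`coboundary_overlap_bounded`), contradicting the crux's extensive-overlap clause.  When `NoLocalIntegrals` is proved,
this composes to the refutation `¬ OddChargeExists`. [folklore] -/
theorem OddChargeExists_false_of_NoLocalIntegrals
    (H : Summit.AtomisticToContinuum.FouriersLaw.Theses.LocalOhmBV.NoLocalIntegrals) : ¬ OddChargeExists := by
  intro hE
  obtain ⟨ω₂, lam, β, γ, hω, hl, hβ, hγ, hP⟩ := oddChargeExists_needs_nonCoboundaryLaw hE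
  obtain ⟨R, g, ψ, hg, hψ, hodd, hcons, hncob⟩ := hP _ rfl
  obtain ⟨k, _hk, hgk⟩ :=
    Summit.AtomisticToContinuum.FouriersLaw.Theorems.DressedCharge.stub_oddChargeCoboundary_of_noLocalIntegrals
      H ω₂ lam β γ hω hl hβ hγ _ rfl R g ψ hg hψ hodd hcons
  exact hncob ⟨k, 0, fun y => by rw [hgk y, add_zero]⟩

end Summit.AtomisticToContinuum.FouriersLaw.Theorems.OddChargeExists.Negative

end
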